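import Mathlib
import Literature.Probability.Percolation.PercolationProofs
import Literature.Probability.LatticeModels.ProdBernoulliIndependence
import Literature.Probability.LatticeModels.ProdBernoulliClusterLocality
import HarnessLib

/-!
# Crux `PercNearOneGluing.AdditiveGluing` (stmt-CriticalPhenomena-4576), line `sigma-recursion-lemma5-any-relay` — stub `stub_sigmaGeometry`

Helper file for the crux (lead prover-line-stmt-CriticalPhenomena-4576-0): proves exactly the
registered stub signature `stub_sigmaGeometry` (the conditional cluster geometry of a σ-layer,
pure path surgery, no measure theory); lands with `--supports stmt-CriticalPhenomena-4576`.

## Content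

Fix a block `O ⊆ Fin n`, a bond configuration `ω` in which every non-loop pair inside `O` is
open, and let `S` be EXACTLY the layer of `O` in `ω`: `x ∈ S ↔ x ∉ O ∧ ∃ o ∈ O, s(o, x) ∈ ω`.
Put `Ψ ω = {e ∈ ω | e avoids O} ∪ {non-loop pairs inside S}` ("forget the pairs meeting `O`,
glue the layer").  Then

* (i) for every `X` disjoint from `O`: `O ↔ X` in `ω` iff `S ↔ X` in `Ψ ω`;
* (ii) for `u, v ∉ O`: `u ↔ v` in `ω` iff `u ↔ v` in `Ψ ω`.

(Folklore; cf. Kozma–Nitzan, arXiv:2401.12397, p. 14: "there is no big difference between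
conditioning on σ and deleting 0".)

## Proof

Everything is phrased for two abstract simple graphs `G` (the open graph of `ω`) and `H` (the
open graph of `Ψ ω`) on a vertex type `V` with finsets `O, S`, linked by six elementary facts:
`G`-edges avoiding `O` are `H`-edges; distinct layer vertices are `H`-adjacent; a `G`-edge
leaving `O` ends in `S`; every `H`-edge is a `G`-edge or a pair inside `S`; every layer vertex
has a `G`-neighbour in `O`; `O` is `G`-connected (a clique).

* (⇒) `sigmaGeometry_walk_cut`: ONE induction over a `G`-walk from `p` to `q ∉ O` proves
  `(p ∉ O → H.Reachable p q) ∧ (p ∈ O → ∃ s ∈ S, H.Reachable s q)`: in the `cons` case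
  `p ~ p₁`, if `p, p₁ ∉ O` the edge is an `H`-edge; if `p ∉ O`, `p₁ ∈ O` then `p ∈ S` and the
  induction hypothesis gives `s ∈ S` reaching `q`, and `p, s ∈ S` are equal or glued; if
  `p ∈ O`, `p₁ ∉ O` then `p₁ ∈ S` and the first clause of the induction hypothesis applies; if
  `p, p₁ ∈ O` use its second clause.
* (⇐) `sigmaGeometry_reachable_lift`: an `H`-edge is either a `G`-edge or a glued pair
  `{s, s'} ⊆ S`, replaced by the `G`-detour `s – o(s) – o(s') – s'`; for (i) prepend `o(s) – s`.

The registered statement `stub_sigmaGeometry` instantiates `G := openGraph ω`,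
`H := openGraph (Ψ ω)` and checks the six facts with `openGraph_adj`, `Sym2.forall_mem_pair`
and `Sym2.mk_isDiag_iff`.
-/

namespace Summit.CriticalPhenomena.PercolationContinuityZ3.Theorems

open MeasureTheory Set
open Literature.Probability.LatticeModels (prodBernoulli)
open Literature.Probability.Percolation (BondConfig openConn openGraph)

noncomputable section
open Classical

section AbstractSurgery

variable {V : Type*} {G H : SimpleGraph V} {O S : Finset V}

/-- Transfer of reachability along edges: if every `H`-edge joins two `G`-connected vertices,
then `H`-reachability implies `G`-reachability. [folklore] -/
theorem sigmaGeometry_reachable_of_adj (h : ∀ x y, H.Adj x y → G.Reachable x y) {u v : V}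
    (huv : H.Reachable u v) : G.Reachable u v := by
  obtain ⟨p⟩ := huv
  induction p with
  | nil => exact SimpleGraph.Reachable.refl _
  | cons ha _ ih => exact (h _ _ ha).trans ih

/-- **Cutting an open walk at its visits to the block.**  If `G`-edges avoiding `O` are
`H`-edges, distinct vertices of `S` are `H`-adjacent, and every `G`-edge leaving `O` ends in
`S`, then for every `G`-walk from `p` to `q ∉ O`: if `p ∉ O` then `H` joins `p` to `q`, and if
`p ∈ O` then `H` joins some `s ∈ S` to `q`. [folklore] -/
theorem sigmaGeometry_walk_cut
    (hGH : ∀ x y, G.Adj x y → x ∉ O → y ∉ O → H.Adj x y)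
    (hSS : ∀ x y, x ∈ S → y ∈ S → x ≠ y → H.Adj x y)
    (hOS : ∀ x y, G.Adj x y → x ∈ O → y ∉ O → y ∈ S) {p q : V} (wk : G.Walk p q) :
    q ∉ O → (p ∉ O → H.Reachable p q) ∧ (p ∈ O → ∃ s ∈ S, H.Reachable s q) := by
  induction wk with
  | nil => exact fun hq => ⟨fun _ => SimpleGraph.Reachable.refl _, fun hp => absurd hp hq⟩
  | @cons a b c hab wk ih =>
    intro hq
    obtain ⟨ih₁, ih₂⟩ := ih hq
    refine ⟨fun ha => ?_, fun ha => ?_⟩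
    · by_cases hb : b ∈ O
      · obtain ⟨s, hsS, hsc⟩ := ih₂ hb
        have haS : a ∈ S := hOS b a hab.symm hb ha
        by_cases has : a = s
        · subst has
          exact hsc
        · exact (hSS a s haS hsS has).reachable.trans hsc
      · exact (hGH a b hab ha hb).reachable.trans (ih₁ hb)
    · by_cases hb : b ∈ O
      · exact ih₂ hb
      · exact ⟨b, hOS a b hab ha hb, ih₁ hb⟩

/-- **Lifting glued walks back.**  If every `H`-edge is a `G`-edge or a pair inside `S`, every
vertex of `S` has a `G`-neighbour in `O`, and `O` is `G`-connected, then `H`-reachability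
implies `G`-reachability (replace a glued pair `{s, s'}` by the detour
`s – o(s) – o(s') – s'`). [folklore] -/
theorem sigmaGeometry_reachable_lift
    (hHG : ∀ x y, H.Adj x y → G.Adj x y ∨ (x ∈ S ∧ y ∈ S))
    (hSO : ∀ y ∈ S, ∃ o ∈ O, G.Adj o y)
    (hOO : ∀ o ∈ O, ∀ o' ∈ O, G.Reachable o o') {u v : V} (huv : H.Reachable u v) :
    G.Reachable u v := by
  refine sigmaGeometry_reachable_of_adj (fun x y hxy => ?_) huv
  rcases hHG x y hxy with h | ⟨hx, hy⟩
  · exact h.reachable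
  · obtain ⟨o, ho, hox⟩ := hSO x hx
    obtain ⟨o', ho', ho'y⟩ := hSO y hy
    exact hox.symm.reachable.trans ((hOO o ho o' ho').trans ho'y.reachable)

/-- **The σ-layer geometry in graph form.**  Under the six linking facts between `G` and `H`:
(i) for `x ∉ O`, `G` joins `O` to `x` iff `H` joins `S` to `x`; (ii) for `u, v ∉ O`, `G` joins
`u` to `v` iff `H` does. [folklore] -/
theorem sigmaGeometry_graph
    (hGH : ∀ x y, G.Adj x y → x ∉ O → y ∉ O → H.Adj x y)
    (hSS : ∀ x y, x ∈ S → y ∈ S → x ≠ y → H.Adj x y)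
    (hOS : ∀ x y, G.Adj x y → x ∈ O → y ∉ O → y ∈ S)
    (hHG : ∀ x y, H.Adj x y → G.Adj x y ∨ (x ∈ S ∧ y ∈ S))
    (hSO : ∀ y ∈ S, ∃ o ∈ O, G.Adj o y)
    (hOO : ∀ o ∈ O, ∀ o' ∈ O, G.Reachable o o') :
    (∀ x, x ∉ O → ((∃ o ∈ O, G.Reachable o x) ↔ ∃ s ∈ S, H.Reachable s x)) ∧
      (∀ u v, u ∉ O → v ∉ O → (G.Reachable u v ↔ H.Reachable u v)) := by
  refine ⟨fun x hx => ⟨?_, ?_⟩, fun u v hu hv => ⟨?_, ?_⟩⟩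
  · rintro ⟨o, ho, ⟨wk⟩⟩
    exact (sigmaGeometry_walk_cut hGH hSS hOS wk hx).2 ho
  · rintro ⟨s, hs, hsx⟩
    obtain ⟨o, ho, hos⟩ := hSO s hs
    exact ⟨o, ho, hos.reachable.trans (sigmaGeometry_reachable_lift hHG hSO hOO hsx)⟩
  · rintro ⟨wk⟩
    exact (sigmaGeometry_walk_cut hGH hSS hOS wk hv).1 hu
  · exact sigmaGeometry_reachable_lift hHG hSO hOO

end AbstractSurgery

/-- Registered stub `stub_sigmaGeometry` of crux stmt-CriticalPhenomena-4576 (line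
sigma-recursion-lemma5-any-relay): the conditional cluster geometry of a σ-layer (path surgery);
see the module docstring and the line skeleton for the informal statement and sources.
[folklore] -/
theorem stub_sigmaGeometry :
    ∀ (n : ℕ) (O S : Finset (Fin n)) (ω : BondConfig (Fin n)),
      (∀ x : Fin n, x ∈ S ↔ (x ∉ O ∧ ∃ o ∈ O, s(o, x) ∈ ω)) →
      (∀ o ∈ O, ∀ o' ∈ O, o ≠ o' → s(o, o') ∈ ω) →
      (∀ X : Finset (Fin n), Disjoint O X →
          (ω ∈ (⋃ o ∈ O, ⋃ x ∈ X, openConn o x) ↔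
            ({e | e ∈ ω ∧ ∀ x ∈ e, x ∉ O} ∪ {e | (∀ x ∈ e, x ∈ S) ∧ ¬ e.IsDiag}) ∈
              (⋃ s ∈ S, ⋃ x ∈ X, openConn s x))) ∧
      (∀ u v : Fin n, u ∉ O → v ∉ O →
          (ω ∈ openConn u v ↔
            ({e | e ∈ ω ∧ ∀ x ∈ e, x ∉ O} ∪ {e | (∀ x ∈ e, x ∈ S) ∧ ¬ e.IsDiag}) ∈
              openConn u v)) := by
  intro n O S ω hS hO
  obtain ⟨h1, h2⟩ := sigmaGeometry_graph (G := openGraph ω)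
    (H := openGraph ({e | e ∈ ω ∧ ∀ x ∈ e, x ∉ O} ∪ {e | (∀ x ∈ e, x ∈ S) ∧ ¬ e.IsDiag}))
    (O := O) (S := S)
    (fun x y hxy hx hy => by
      rw [Literature.Probability.Percolation.openGraph_adj] at hxy ⊢
      exact ⟨Or.inl ⟨hxy.1, Sym2.forall_mem_pair.2 ⟨hx, hy⟩⟩, hxy.2⟩)
    (fun x y hx hy hxy => by
      rw [Literature.Probability.Percolation.openGraph_adj]
      exact ⟨Or.inr ⟨Sym2.forall_mem_pair.2 ⟨hx, hy⟩, fun h => hxy (Sym2.mk_isDiag_iff.1 h)⟩,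
        hxy⟩)
    (fun x y hxy hx hy =>
      (hS y).2 ⟨hy, x, hx, ((Literature.Probability.Percolation.openGraph_adj ω x y).1 hxy).1⟩)
    (fun x y hxy => by
      rw [Literature.Probability.Percolation.openGraph_adj] at hxy
      obtain ⟨h | h, hne⟩ := hxy
      · exact Or.inl ((Literature.Probability.Percolation.openGraph_adj ω x y).2 ⟨h.1, hne⟩)
      · exact Or.inr (Sym2.forall_mem_pair.1 h.1))
    (fun y hy => by
      obtain ⟨hyO, o, ho, hoy⟩ := (hS y).1 hy
      exact ⟨o, ho, (Literature.Probability.Percolation.openGraph_adj ω o y).2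
        ⟨hoy, fun h => hyO (h ▸ ho)⟩⟩)
    (fun o ho o' ho' => by
      by_cases h : o = o'
      · subst h
        exact SimpleGraph.Reachable.refl _
      · exact ((Literature.Probability.Percolation.openGraph_adj ω o o').2
          ⟨hO o ho o' ho' h, h⟩).reachable)
  refine ⟨fun X hX => ?_, fun u v hu hv => h2 u v hu hv⟩
  simp only [Set.mem_iUnion, exists_prop]
  constructor
  · rintro ⟨o, ho, x, hx, hox⟩
    have hxO : x ∉ O := fun h => Finset.disjoint_left.1 hX h hx
    obtain ⟨s, hs, hsx⟩ := (h1 x hxO).1 ⟨o, ho, hox⟩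
    exact ⟨s, hs, x, hx, hsx⟩
  · rintro ⟨s, hs, x, hx, hsx⟩
    have hxO : x ∉ O := fun h => Finset.disjoint_left.1 hX h hx
    obtain ⟨o, ho, hox⟩ := (h1 x hxO).2 ⟨s, hs, hsx⟩
    exact ⟨o, ho, x, hx, hox⟩

end

end Summit.CriticalPhenomena.PercolationContinuityZ3.Theorems
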